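import Summits.HodgeConjecture.HodgeConjecture.Theorems.R90S6EllipticIdentityTwoStepRecursion   -- ★ E1-ARITH (this hand): (AR.0)–(AR.3)
import HarnessLib

/-!
# R90 · S6 — CARD E1-ANCHOR-ARITH «(E1′) FOR ALL `m ≥ 1` FROM THE TWO ANCHORS AND THE BALANCE, IN THE SHEET'S DATA LETTERS» (`Theorems/R90S6EllipticIdentityAnchors.lean`)

Cell `hodgecm-mathlib`, crux H413 (`stmt-HodgeConjecture-24833`), route of record `HCCMUnconditional`; programme R90-TF, section S6 (base `R90-C14`), hand K2E3-p21 (g9)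
(cross-line valve; card named by R90-C14-plan (g2), R90 bus 2026-09-05T02:18:38Z «E1-ANCHOR-ARITH»; pre-census 02:25:59Z (AN.1)–(AN.4)).  Helper lane
`--supports stmt-HodgeConjecture-24833 --as helper`; THEOREMS ONLY (no definition, no instance, no notation, no named fact, no `sorry`); imports ★ E1-ARITH + HarnessLib only.
Every displayed expression is BYTE-SHAPED on typ1 (g3)'s (E1) sheet v1.1 b34a14586f4152ce :276–:284 (the (E1′) conclusion: G side
`((if Even m then q ^ (2 * m - 3) * N'₁ᵢ else q ^ (2 * (m - 1)) * N'₀ᵢ : ℕ) : ℂ)` κ-signed `(+,+,−,−)` times the Δ‴-scalar; H side = ★ H2-NUMBERS :53–:55 summed over `j = 1, 2`),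
with the Δ‴-scalar `(-(q : ℂ)) ^ WithZero.log (Valued.v ((b - a) * (b - c)))` abstracted to a letter `Δ : ℂ` (the consumer instantiates it; nothing here depends on it).

THE MATHEMATICS (sheet v1.1 PROVER'S NOTE :287–:300, dealer 02:09:49Z).  In the data currency both sides of (E1′) obey `X(m+2) = q⁴ X(m)` up to the H-side cross term
`∓(q²−1) q^{2m+1} D`, `D = Σⱼ (N₀ⱼ − N₁ⱼ)`; so with the first-shell balance `D = 0` (HF1.2, the type-swap symmetry) the identity for all `m ≥ 1` is EQUIVALENT to its two
anchors `m = 1, 2`, which in data letters are the LINEAR identities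
(AN.1) `Δ · (N'₀₁ + N'₀₂ − N'₀₃ − N'₀₄) = Σⱼ ((q²−1) F₀ⱼ − q N₀ⱼ)` and (AN.2) `Δ · q · (N'₁₁ + N'₁₂ − N'₁₃ − N'₁₄) = Σⱼ ((q²−1) q² F₀ⱼ − (q²−1) q N₀ⱼ + q³ N₁ⱼ)`.
* (AN.3) `natCast_gClosed` (the ℕ-cast G-side summand of the sheet = the ℂ-side `G` of ★ E1-ARITH), `kappaSum_gClosed_two_step` (the κ-signed Δ-weighted four-term sum obeys
  `X(m+2) = q⁴ X(m)`); (AN.1)∕(AN.2) `sum_hClosed_one`, `sum_hClosed_two`, `kappaSum_gClosed_one`, `kappaSum_gClosed_two` (the two sides at `m = 1, 2` SIMPLIFY to the linear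
  forms); **HEAD (AN.4) `kappaSum_closedShell_eq_sum_hClosed_of_anchors`**: (E1′)'s conclusion (sheet :276–:284 bytes, `Δ` abstracted) for every `m ≥ 1` from (AN.1), (AN.2), `D = 0`.

HONEST LABEL: HC_CM is proved only modulo the 7 printed citations (2 remaining named inputs: hLiu418 = stmt-HodgeConjecture-24832, h413 =
stmt-HodgeConjecture-24833) until rung 0 closes; arithmetic bookkeeping, count-neutral until (E1) consumes it; REL ≠ ★ ≠ WRITTEN ≠ BUILT.

## References
* [Macdonald1971] I. G. Macdonald, *Spherical Functions on a Group of p-adic Type* (1971), Ch. V §3.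
* [Serre1980Trees] J.-P. Serre, *Trees* (1980), I.6.4 Prop. 24.
-/

set_option autoImplicit false
-- the mandated namespace repeats the single-problem summit's segment (`HodgeConjecture.HodgeConjecture`)
set_option linter.dupNamespace false

namespace Summit.HodgeConjecture.HodgeConjecture.R90.S6

/-! ## (AN.3) The sheet's ℕ-cast G-side summand and the two-step recursion of the κ-signed sum -/

/-- The sheet's ℕ-cast G-side closed shell equals ★ E1-ARITH's ℂ-side `G`-summand. [folklore] -/
theorem natCast_gClosed (q N₀' N₁' m : ℕ) :
    (((if Even m then q ^ (2 * m - 3) * N₁' else q ^ (2 * (m - 1)) * N₀' : ℕ)) : ℂ) =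
      (if Even m then (q : ℂ) ^ (2 * m - 3) * (N₁' : ℂ) else (q : ℂ) ^ (2 * (m - 1)) * (N₀' : ℂ)) := by
  split_ifs <;> push_cast <;> rfl

/-- **(AN.3)** The κ-signed, `Δ`-weighted four-term G-side sum of (E1′) obeys `X(m+2) = q⁴ · X(m)` (`m ≥ 1`) — ★ `gClosed_two_step` four times. [cite: Macdonald1971, Ch. V §3] -/
theorem kappaSum_gClosed_two_step (q : ℕ) (Δ : ℂ) (N'₀₁ N'₁₁ N'₀₂ N'₁₂ N'₀₃ N'₁₃ N'₀₄ N'₁₄ : ℕ) (m : ℕ) (hm : 1 ≤ m) :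
    Δ * ((((if Even (m + 2) then q ^ (2 * (m + 2) - 3) * N'₁₁ else q ^ (2 * ((m + 2) - 1)) * N'₀₁ : ℕ)) : ℂ) +
          (((if Even (m + 2) then q ^ (2 * (m + 2) - 3) * N'₁₂ else q ^ (2 * ((m + 2) - 1)) * N'₀₂ : ℕ)) : ℂ) -
          (((if Even (m + 2) then q ^ (2 * (m + 2) - 3) * N'₁₃ else q ^ (2 * ((m + 2) - 1)) * N'₀₃ : ℕ)) : ℂ) -
          (((if Even (m + 2) then q ^ (2 * (m + 2) - 3) * N'₁₄ else q ^ (2 * ((m + 2) - 1)) * N'₀₄ : ℕ)) : ℂ)) =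
      (q : ℂ) ^ 4 * (Δ * ((((if Even m then q ^ (2 * m - 3) * N'₁₁ else q ^ (2 * (m - 1)) * N'₀₁ : ℕ)) : ℂ) +
          (((if Even m then q ^ (2 * m - 3) * N'₁₂ else q ^ (2 * (m - 1)) * N'₀₂ : ℕ)) : ℂ) -
          (((if Even m then q ^ (2 * m - 3) * N'₁₃ else q ^ (2 * (m - 1)) * N'₀₃ : ℕ)) : ℂ) -
          (((if Even m then q ^ (2 * m - 3) * N'₁₄ else q ^ (2 * (m - 1)) * N'₀₄ : ℕ)) : ℂ))) := by
  rw [natCast_gClosed, natCast_gClosed, natCast_gClosed, natCast_gClosed, natCast_gClosed, natCast_gClosed, natCast_gClosed, natCast_gClosed,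
    gClosed_two_step q N'₀₁ N'₁₁ m hm, gClosed_two_step q N'₀₂ N'₁₂ m hm, gClosed_two_step q N'₀₃ N'₁₃ m hm, gClosed_two_step q N'₀₄ N'₁₄ m hm]
  ring

/-! ## (AN.1)∕(AN.2) The two sides at `m = 1, 2` in linear form -/

/-- (AN.1, G side) at `m = 1`: the κ-signed G-side sum is `Δ · (N'₀₁ + N'₀₂ − N'₀₃ − N'₀₄)`. [folklore] -/
theorem kappaSum_gClosed_one (q : ℕ) (Δ : ℂ) (N'₀₁ N'₁₁ N'₀₂ N'₁₂ N'₀₃ N'₁₃ N'₀₄ N'₁₄ : ℕ) :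
    Δ * ((((if Even 1 then q ^ (2 * 1 - 3) * N'₁₁ else q ^ (2 * (1 - 1)) * N'₀₁ : ℕ)) : ℂ) +
          (((if Even 1 then q ^ (2 * 1 - 3) * N'₁₂ else q ^ (2 * (1 - 1)) * N'₀₂ : ℕ)) : ℂ) -
          (((if Even 1 then q ^ (2 * 1 - 3) * N'₁₃ else q ^ (2 * (1 - 1)) * N'₀₃ : ℕ)) : ℂ) -
          (((if Even 1 then q ^ (2 * 1 - 3) * N'₁₄ else q ^ (2 * (1 - 1)) * N'₀₄ : ℕ)) : ℂ)) =
      Δ * ((N'₀₁ : ℂ) + (N'₀₂ : ℂ) - (N'₀₃ : ℂ) - (N'₀₄ : ℂ)) := by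
  have h1 : ¬ Even 1 := Nat.not_even_one
  simp only [if_neg h1]
  push_cast
  ring

/-- (AN.2, G side) at `m = 2`: the κ-signed G-side sum is `Δ · q · (N'₁₁ + N'₁₂ − N'₁₃ − N'₁₄)`. [folklore] -/
theorem kappaSum_gClosed_two (q : ℕ) (Δ : ℂ) (N'₀₁ N'₁₁ N'₀₂ N'₁₂ N'₀₃ N'₁₃ N'₀₄ N'₁₄ : ℕ) :
    Δ * ((((if Even 2 then q ^ (2 * 2 - 3) * N'₁₁ else q ^ (2 * (2 - 1)) * N'₀₁ : ℕ)) : ℂ) +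
          (((if Even 2 then q ^ (2 * 2 - 3) * N'₁₂ else q ^ (2 * (2 - 1)) * N'₀₂ : ℕ)) : ℂ) -
          (((if Even 2 then q ^ (2 * 2 - 3) * N'₁₃ else q ^ (2 * (2 - 1)) * N'₀₃ : ℕ)) : ℂ) -
          (((if Even 2 then q ^ (2 * 2 - 3) * N'₁₄ else q ^ (2 * (2 - 1)) * N'₀₄ : ℕ)) : ℂ)) =
      Δ * ((q : ℂ) * ((N'₁₁ : ℂ) + (N'₁₂ : ℂ) - (N'₁₃ : ℂ) - (N'₁₄ : ℂ))) := by
  have h2 : Even 2 := even_two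
  simp only [if_pos h2]
  push_cast
  ring

/-- (AN.1, H side) at `m = 1`: `RHS(1) = (q²−1) F₀ − q N₀` (★ :53–:55 at `m := 1`; `Finset.Ico 1 1 = ∅`). [folklore] -/
theorem sum_hClosed_one (q F₀ N₀ N₁ : ℕ) :
    ((q : ℂ) ^ 2 - 1) * (q : ℂ) ^ (2 * (1 - 1)) * F₀ +
        ((q : ℂ) ^ 2 - 1) * (q : ℂ) ^ (2 * 1 - 3) * (∑ k ∈ Finset.Ico 1 1, (-1 : ℂ) ^ k * (if Even k then (N₁ : ℂ) else (N₀ : ℂ))) +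
        (-1 : ℂ) ^ 1 * (q : ℂ) ^ (2 * 1 - 1) * (if Even 1 then (N₁ : ℂ) else (N₀ : ℂ)) =
      ((q : ℂ) ^ 2 - 1) * (F₀ : ℂ) - (q : ℂ) * (N₀ : ℂ) := by
  have h1 : ¬ Even 1 := Nat.not_even_one
  rw [Finset.Ico_self, Finset.sum_empty, if_neg h1]
  norm_num
  ring

/-- (AN.2, H side) at `m = 2`: `RHS(2) = (q²−1) q² F₀ − (q²−1) q N₀ + q³ N₁` (★ :53–:55 at `m := 2`; `Finset.Ico 1 2 = {1}`). [folklore] -/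
theorem sum_hClosed_two (q F₀ N₀ N₁ : ℕ) :
    ((q : ℂ) ^ 2 - 1) * (q : ℂ) ^ (2 * (2 - 1)) * F₀ +
        ((q : ℂ) ^ 2 - 1) * (q : ℂ) ^ (2 * 2 - 3) * (∑ k ∈ Finset.Ico 1 2, (-1 : ℂ) ^ k * (if Even k then (N₁ : ℂ) else (N₀ : ℂ))) +
        (-1 : ℂ) ^ 2 * (q : ℂ) ^ (2 * 2 - 1) * (if Even 2 then (N₁ : ℂ) else (N₀ : ℂ)) =
      ((q : ℂ) ^ 2 - 1) * (q : ℂ) ^ 2 * (F₀ : ℂ) - ((q : ℂ) ^ 2 - 1) * (q : ℂ) * (N₀ : ℂ) + (q : ℂ) ^ 3 * (N₁ : ℂ) := by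
  have h1 : ¬ Even 1 := Nat.not_even_one
  have h2 : Even 2 := even_two
  have hI : Finset.Ico 1 2 = {1} := by decide
  rw [hI, Finset.sum_singleton, if_neg h1, if_pos h2]
  norm_num
  ring

/-! ## (AN.4) HEAD: (E1′) for every `m ≥ 1` from the two anchors and the balance -/

/-- **(AN.4) — (E1′) FOR ALL `m ≥ 1` FROM ITS ANCHORS, IN THE SHEET'S DATA LETTERS.**  With the Δ‴-scalar abstracted to `Δ : ℂ`, the G-side first-shell data `N'₀ᵢ, N'₁ᵢ`
(`i = 1…4`, κ-signs `+,+,−,−`) and the H-side data `(F₀ⱼ, N₀ⱼ, N₁ⱼ)` (`j = 1, 2`): if the first-shell balance `N₀₁ + N₀₂ = N₁₁ + N₁₂` holds (HF1.2) and the two LINEAR anchors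
(AN.1) `Δ (N'₀₁ + N'₀₂ − N'₀₃ − N'₀₄) = Σⱼ ((q²−1) F₀ⱼ − q N₀ⱼ)`, (AN.2) `Δ q (N'₁₁ + N'₁₂ − N'₁₃ − N'₁₄) = Σⱼ ((q²−1) q² F₀ⱼ − (q²−1) q N₀ⱼ + q³ N₁ⱼ)` hold, then the (E1′)
display (sheet v1.1 :276–:284, `Δ` for the scalar) holds for every `m ≥ 1` (★ `eq_sum_hClosed_of_anchors` at `G := ` the κ-signed sum, ★ `kappaSum_gClosed_two_step`).
[cite: Macdonald1971, Ch. V §3] [cite: Serre1980Trees, I.6.4 Prop. 24] -/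
theorem kappaSum_closedShell_eq_sum_hClosed_of_anchors (q : ℕ) (Δ : ℂ) (N'₀₁ N'₁₁ N'₀₂ N'₁₂ N'₀₃ N'₁₃ N'₀₄ N'₁₄ : ℕ) (F₀₁ N₀₁ N₁₁ F₀₂ N₀₂ N₁₂ : ℕ)
    (hD : N₀₁ + N₀₂ = N₁₁ + N₁₂)
    (h1 : Δ * ((N'₀₁ : ℂ) + (N'₀₂ : ℂ) - (N'₀₃ : ℂ) - (N'₀₄ : ℂ)) =
      (((q : ℂ) ^ 2 - 1) * (F₀₁ : ℂ) - (q : ℂ) * (N₀₁ : ℂ)) + (((q : ℂ) ^ 2 - 1) * (F₀₂ : ℂ) - (q : ℂ) * (N₀₂ : ℂ)))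
    (h2 : Δ * ((q : ℂ) * ((N'₁₁ : ℂ) + (N'₁₂ : ℂ) - (N'₁₃ : ℂ) - (N'₁₄ : ℂ))) =
      (((q : ℂ) ^ 2 - 1) * (q : ℂ) ^ 2 * (F₀₁ : ℂ) - ((q : ℂ) ^ 2 - 1) * (q : ℂ) * (N₀₁ : ℂ) + (q : ℂ) ^ 3 * (N₁₁ : ℂ)) +
        (((q : ℂ) ^ 2 - 1) * (q : ℂ) ^ 2 * (F₀₂ : ℂ) - ((q : ℂ) ^ 2 - 1) * (q : ℂ) * (N₀₂ : ℂ) + (q : ℂ) ^ 3 * (N₁₂ : ℂ)))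
    {m : ℕ} (hm : 1 ≤ m) :
    Δ * ((((if Even m then q ^ (2 * m - 3) * N'₁₁ else q ^ (2 * (m - 1)) * N'₀₁ : ℕ)) : ℂ) +
          (((if Even m then q ^ (2 * m - 3) * N'₁₂ else q ^ (2 * (m - 1)) * N'₀₂ : ℕ)) : ℂ) -
          (((if Even m then q ^ (2 * m - 3) * N'₁₃ else q ^ (2 * (m - 1)) * N'₀₃ : ℕ)) : ℂ) -
          (((if Even m then q ^ (2 * m - 3) * N'₁₄ else q ^ (2 * (m - 1)) * N'₀₄ : ℕ)) : ℂ)) =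
      (((q : ℂ) ^ 2 - 1) * (q : ℂ) ^ (2 * (m - 1)) * (F₀₁ : ℂ) +
          ((q : ℂ) ^ 2 - 1) * (q : ℂ) ^ (2 * m - 3) * (∑ k ∈ Finset.Ico 1 m, (-1 : ℂ) ^ k * (if Even k then (N₁₁ : ℂ) else (N₀₁ : ℂ))) +
          (-1 : ℂ) ^ m * (q : ℂ) ^ (2 * m - 1) * (if Even m then (N₁₁ : ℂ) else (N₀₁ : ℂ))) +
        (((q : ℂ) ^ 2 - 1) * (q : ℂ) ^ (2 * (m - 1)) * (F₀₂ : ℂ) +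
          ((q : ℂ) ^ 2 - 1) * (q : ℂ) ^ (2 * m - 3) * (∑ k ∈ Finset.Ico 1 m, (-1 : ℂ) ^ k * (if Even k then (N₁₂ : ℂ) else (N₀₂ : ℂ))) +
          (-1 : ℂ) ^ m * (q : ℂ) ^ (2 * m - 1) * (if Even m then (N₁₂ : ℂ) else (N₀₂ : ℂ))) := by
  -- ★ E1-ARITH (AR.3) at `G := ` the κ-signed, `Δ`-weighted G-side sum
  refine eq_sum_hClosed_of_anchors q
    (fun n => Δ * ((((if Even n then q ^ (2 * n - 3) * N'₁₁ else q ^ (2 * (n - 1)) * N'₀₁ : ℕ)) : ℂ) +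
          (((if Even n then q ^ (2 * n - 3) * N'₁₂ else q ^ (2 * (n - 1)) * N'₀₂ : ℕ)) : ℂ) -
          (((if Even n then q ^ (2 * n - 3) * N'₁₃ else q ^ (2 * (n - 1)) * N'₀₃ : ℕ)) : ℂ) -
          (((if Even n then q ^ (2 * n - 3) * N'₁₄ else q ^ (2 * (n - 1)) * N'₀₄ : ℕ)) : ℂ)))
    (fun n hn => kappaSum_gClosed_two_step q Δ N'₀₁ N'₁₁ N'₀₂ N'₁₂ N'₀₃ N'₁₃ N'₀₄ N'₁₄ n hn)
    F₀₁ N₀₁ N₁₁ F₀₂ N₀₂ N₁₂ hD ?_ ?_ m hm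
  · -- anchor `m = 1`
    rw [kappaSum_gClosed_one, sum_hClosed_one, sum_hClosed_one]
    exact h1
  · -- anchor `m = 2`
    rw [kappaSum_gClosed_two, sum_hClosed_two, sum_hClosed_two]
    exact h2

end Summit.HodgeConjecture.HodgeConjecture.R90.S6
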